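import Literature.AlgebraicGeometry.FiniteFields.HyperellipticHasseWittMatrix
import Literature.Algebra.Polynomial.CartierOperator
import HarnessLib

/-!
# The Cartier–Manin matrix of a superelliptic curve `y^m = f(x)` in block form
# (Sutherland, ANTS XIV 2020, §2 «The Cartier operator»: Stöhr–Voloch (2)–(5), Lemma 6, (7), (8), Theorem 8)

Topic `Literature/AlgebraicGeometry/FiniteFields`; namespace `Literature.AlgebraicGeometry.FiniteFields`.
Lane `lit-hodgefound` (Track 2 foundations library), seat p01 gen 20, row g20-#3.  FOUR definitions
with bodies (`powCoeffMatrix`, `superellipticBlockSize`, `superellipticExponent`, `superellipticBlock`)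
+ theorems; no named fact, no instance, no notation (D-0014/D-0026; net Literature debt 0).  Sequel BY
IMPORT of `HyperellipticHasseWittMatrix.lean` (p01 gen 19: `hasseWittMatrix f q g` — here exhibited as
the square case `powCoeffMatrix f q ((q−1)/2) g g`, by `rfl`) and of
`Literature/Algebra/Polynomial/CartierOperator.lean` (p01 gen 20, g20-#1: the twisted Cartier operator
`cartierTwist p = U_p : f ↦ Σ_n [x^{pn+p−1}] f xⁿ` and `cartier p = 𝒞` over a perfect ring) — REUSED,
nothing restated.

## Source, VERBATIM

A. V. Sutherland, *Counting points on superelliptic curves in average polynomial time*, ANTS XIV,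
Open Book Series 4 (2020) 403–422 [Sutherland2020] (held: `paper:arxiv-2004.10189-gx24605700`,
p0004–p0008 = §2):

> […] every rational differential form `ω = z dx` can be uniquely written in the form
> `ω = (z_0^p + z_1^p x + ⋯ + z_{p−1}^p x^{p−1}) dx`. The (modified) Cartier operator
> `𝒞 : Ω_K → Ω_K` is then defined by `𝒞(ω) := z_{p−1} dx`. […]
> **Definition 4.** Let `ω := (ω_1, …, ω_g)` be a basis for `Ω_K(0)` and define `a_{ij} ∈ k` via
> `𝒞(ω_j) = Σ_{i=1}^{g} a_{ij} ω_i`. The Cartier–Manin matrix of `K` (with respect to `ω`) is the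
> matrix `A := [a_{ij}] ∈ k^{g×g}`.
> […] `∇ := ∂^{2p−2}/∂x^{p−1}∂y^{p−1}`, which maps `x^{(i+1)p−1} y^{(j+1)p−1}` to `x^{ip} y^{jp}` and
> annihilates monomials not of this form […] (2) `𝒞(h dx/F_y) = (∇(F^{p−1} h))^{1/p} dx/F_y` given by
> [Stöhr–Voloch, Thm. 1.1]. […] (3) `ω_{kℓ} := x^{k−1} y^{ℓ−1} dx/F_y` […]
> (5) `𝒞(ω_{kℓ}) = Σ_{i,j≥1} (F^{p−1}_{ip−k, jp−ℓ})^{1/p} ω_{ij}`.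
> **Lemma 6.** Let `k` be a perfect field of positive characteristic `p`, let `X/k` be a superelliptic
> curve defined by `F(x,y) := y^m − f(x) = 0`, let `d := deg f`, and for `i, j ≥ 1` let
> `ω_{ij} := x^{i−1} y^{j−1} dx/F_y ∈ Ω_K` […]. Then the set `ω := {ω_{ij} : mi + dj < md}` is a
> `k`-basis for `Ω_K(0)` […]. Moreover, if we define (6) `d_j := d − ⌊dj/m⌋ − 1` and
> `m_i := m − ⌊mi/d⌋ − 1`, then the `ω_{ij} ∈ ω` are precisely those for which `1 ≤ i ≤ d_j` and
> `1 ≤ j ≤ m_i`. *Proof.* Note that `ω_{ij} = (1/m) x^{i−1} y^{j−m} dx`, with `p ∤ m`. […]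
> `F^{p−1}_{ip−k, jp−ℓ} = f^{p−1−(jp−ℓ)/m}_{ip−k}` if `m ∣ (jp−ℓ)`, `0` otherwise. Now `1 ≤ j, ℓ < m`
> and `p ∤ m`, so whenever `F^{p−1}_{ip−k, jp−ℓ} ≠ 0` we must have `ℓ = jp rem m > 0` and
> (7) `n_j := p − 1 − (jp − ℓ)/m = ((m−j)p − (m−ℓ))/m = p − 1 − ⌊jp/m⌋`.
> […] The Cartier–Manin matrix of `X` can then be described in block form with blocks indexed by `j`
> and `ℓ` containing entries indexed by `i` and `k`:
> (8) `A_p := [B^{jℓ}]_{jℓ}`, `1 ≤ j, ℓ ≤ μ := m_1 = m − ⌊m/d⌋ − 1`;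
> `B^{jℓ} := [(b^{jℓ}_{ik})^{1/p}]_{ik}`, `1 ≤ i ≤ d_j` and `1 ≤ k ≤ d_ℓ`;
> `b^{jℓ}_{ik} := f^{n_j}_{ip−k}` if `(jp−ℓ)/m ∈ ℤ_{≥0}`, `0` otherwise.
> The diagonal blocks `B^{jj}` are square but the others typically will not be square […] there is
> at most one nonzero `B^{jℓ}` in each row `j`, and in each column `ℓ` of `[B^{jℓ}]_{jℓ}`, since any
> nonzero `B^{jℓ}` must have `ℓ ≡ jp mod m` […].
> **Example 7.** For `m = 5` and `d = 3` we have `g = 4` […]. For `m = 3` and `d = 5` we also have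
> `g = 4` but now the `4 × 4` matrix `A_p` consists of `2 × 2 = 4` blocks: one `3 × 3`, one `3 × 1`,
> one `1 × 3`, and one `1 × 1`.
> **Theorem 8.** Let `X : y^m = f(x)` be a superelliptic curve over a perfect field of characteristic
> `p > 0` with `d := deg(f)`. […] the Cartier operator maps the subspace spanned by `ω_j` to the
> subspace spanned by `ω_ℓ`, with `ℓ ≡ jp mod m`, and this action is given by the matrix `B^{jℓ}`
> defined in (8). In particular, when `p ≡ 1 mod m` the Cartier operator fixes each of the subspaces
> spanned by `ω_i`. *Proof.* This is an immediate consequence of (8).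

## What is formalised (pure polynomial algebra) and the direction of the blocks

From «`ω_{ij} = (1/m) x^{i−1} y^{j−m} dx`» and `y^m = f`: if `m ∣ jp − ℓ`, `ℓ ≤ jp`, then
`y^{ℓ−m} = y^{−p(m−j)} · f^{n_j}` (exponents: `−p(m−j) + m n_j = ℓ − m` by (7)), so by
`𝒞(z^p ω) = z 𝒞(ω)`:  `m · y^{m−j} · 𝒞(ω_{kℓ}) = 𝒞(x^{k−1} f^{n_j} dx)`.  Hence the polynomial
identity proved here — `U_p(x^{k−1} f^{n_j}) = Σ_{i ≤ d_j} b^{jℓ}_{ik} x^{i−1}` for `k ≤ d_ℓ`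
(`cartierTwist_X_pow_mul_pow_superelliptic`, with its `𝒞`/`τ`-form `cartier_X_pow_mul_pow_superelliptic`
«`B^{jℓ} := [(b^{jℓ}_{ik})^{1/p}]`») — IS (8): `𝒞(ω_{kℓ}) = Σ_i B^{jℓ}_{ik} ω_{ij}`, the block
`B^{jℓ}` (rows `i ≤ d_j`, columns `k ≤ d_ℓ`) carrying the `ω_ℓ`-block INTO the `ω_j`-block, for the
unique `j` with `ℓ ≡ jp (mod m)` (`existsUnique_superelliptic_block`), consistent with Definition 4
(`a_{ij}`: column index = source).  [Theorem 8's prose «maps the subspace spanned by `ω_j` to the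
subspace spanned by `ω_ℓ`» names the two blocks in the opposite order; the matrix statement (8), which
is what is formalised, is unambiguous.]  The heart is the DEGREE LEMMA
`natDegree_lt_superelliptic`: `(k−1) + n_j · d < p · d_j + p − 1` for `k ≤ d_ℓ` — precisely
`m · (slack) = p · (dj mod m) + m · (d_ℓ − k) + (m − (dℓ mod m)) > 0` — which is the coefficient
shadow of «it maps regular differentials to regular differentials» for the basis of Lemma 6.

§0 `powCoeffMatrix f q n r c = ([x^{q(i+1)−(k+1)}] fⁿ)_{i<r, k<c}` (rectangular; the tree's
`hasseWittMatrix f q g` is `powCoeffMatrix f q ((q−1)/2) g g`, `hasseWittMatrix_eq_powCoeffMatrix`);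
the generic column identity `cartierTwist_X_pow_mul_pow_eq_sum` and its `mulVec` form.
§1 `superellipticBlockSize m d j = d_j`, `superellipticExponent p m j ℓ = n_j`, `superellipticBlock f p m
d j ℓ = b^{jℓ}` («`f^{n_j}_{ip−k}` if `(jp−ℓ)/m ∈ ℤ_{≥0}`, `0` otherwise»); `natDegree_lt_superelliptic`;
**`cartierTwist_X_pow_mul_pow_superelliptic`**, `cartierTwist_sum_mul_pow_superelliptic` (mulVec),
**`cartier_X_pow_mul_pow_superelliptic`** / `cartier_sum_mul_pow_superelliptic` (perfect ring, the
`p`-th roots `B^{jℓ} = (b^{jℓ})^{τ}` and the `τ`-linearity); block selection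
`superelliptic_dvd_iff_mod_eq`, **`existsUnique_superelliptic_block`** («any nonzero `B^{jℓ}` must have
`ℓ ≡ jp mod m`»; `p ∤ m`), `superelliptic_block_self_of_mod_eq_one` («when `p ≡ 1 mod m` … fixes each
of the subspaces»).
§2 Consistency and examples: `m = 2` — `superellipticBlockSize_two_odd/even` (`d_1 = g` for
`d = 2g+1, 2g+2`), `superellipticExponent_two` (`n_1 = (p−1)/2`), `superellipticBlock_two_apply_odd/even`
(`b^{11} =` the tree's `hasseWittMatrix f p g` entrywise); Example 7 (`m = 3`, `d = 5`): block sizes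
`d_1 = 3`, `d_2 = 1` and the exponents for `p ≡ 1, 2 (mod 3)`.

## Honest scope

The function-field Cartier operator, the Stöhr–Voloch formula (2) and the basis / regularity statement
of Lemma 6 are QUOTED, not formalised (no function field of `y^m = f(x)` in the tree at this level);
what is proved is the coefficient and degree content that makes (8) a well-defined block matrix
computing `U_p` / `𝒞` on the polynomial forms `x^{k−1} f^{n_j} dx`, the block combinatorics of
Theorem 8, and the `m = 2` / Example 7 checks.  No square-freeness of `f`, no `p > d` is used; `p` is
any positive integer in §0–§1 except where `𝒞` (prime `p`, perfect `R`) or `p ∤ m` is stated.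
-/

noncomputable section

open Polynomial Finset Matrix Literature.Algebra.Polynomial

namespace Literature.AlgebraicGeometry.FiniteFields

/-! ### §0 The rectangular coefficient matrices `([x^{q(i+1)−(k+1)}] fⁿ)` and `U_q` -/

section PowCoeff

variable {R : Type*} [CommRing R]

/-- The `r × c` **power-coefficient matrix** `([x^{q(i+1) − (k+1)}] fⁿ)_{i<r, k<c}` (a negative index
contributing `0`), realised as the coefficient of `x^{q(i+1)}` in `x^{k+1} fⁿ`: the common shape of the
Hasse–Witt matrix `W_q(f)` (`n = (q−1)/2`, `r = c = g`) and of Sutherland's blocks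
`b^{jℓ} = (f^{n_j}_{ip−k})_{i ≤ d_j, k ≤ d_ℓ}`. [cite: Sutherland2020, §2 eq. (8)]
[cite: HarveySutherland2016, §1] -/
def powCoeffMatrix (f : R[X]) (q n r c : ℕ) : Matrix (Fin r) (Fin c) R :=
  Matrix.of fun i k => (X ^ (k.val + 1) * f ^ n).coeff (q * (i.val + 1))

/-- The entries: `[x^{q(i+1) − (k+1)}] fⁿ` when the index is `≥ 0`, else `0` («`f^{n_j}_{ip−k}`»).
[cite: Sutherland2020, §2 eq. (8)] -/
theorem powCoeffMatrix_apply (f : R[X]) (q n r c : ℕ) (i : Fin r) (k : Fin c) :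
    powCoeffMatrix f q n r c i k =
      if k.val + 1 ≤ q * (i.val + 1) then (f ^ n).coeff (q * (i.val + 1) - (k.val + 1)) else 0 := by
  rw [powCoeffMatrix, of_apply, coeff_X_pow_mul']

/-- The entries re-indexed for the Cartier extraction: `M_{ik} = [x^{qi + (q−1)}] (x^k fⁿ)`.
[cite: Sutherland2020, §2 eq. (4)–(5)] -/
theorem powCoeffMatrix_apply_eq_coeff_X_pow_mul (f : R[X]) {q : ℕ} (hq : 1 ≤ q) (n r c : ℕ)
    (i : Fin r) (k : Fin c) :
    powCoeffMatrix f q n r c i k = (X ^ k.val * f ^ n).coeff (q * i.val + (q - 1)) := by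
  rw [powCoeffMatrix, of_apply, show q * (i.val + 1) = (q * i.val + (q - 1)) + 1 by
    rw [mul_add, mul_one]; omega, pow_succ', mul_assoc, coeff_X_mul]

/-- The diagonal of a square power-coefficient matrix: `M_{jj} = [x^{(j+1)(q−1)}] fⁿ`.
[cite: Sutherland2020, §2 eq. (8)] -/
theorem powCoeffMatrix_apply_self (f : R[X]) {q : ℕ} (hq : 1 ≤ q) (n r : ℕ) (j : Fin r) :
    powCoeffMatrix f q n r r j j = (f ^ n).coeff ((j.val + 1) * (q - 1)) := by
  rw [powCoeffMatrix_apply, if_pos (by nlinarith), Nat.mul_sub_one, mul_comm]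

/-- The tree's Hasse–Witt matrix is the square power-coefficient matrix with exponent `(q−1)/2`:
`W_q(f) = ([x^{q(i+1)−(k+1)}] f^{(q−1)/2})_{i,k<g}`. [cite: HarveySutherland2016, §1] -/
theorem hasseWittMatrix_eq_powCoeffMatrix (f : R[X]) (q g : ℕ) :
    hasseWittMatrix f q g = powCoeffMatrix f q ((q - 1) / 2) g g := rfl

/-- **The generic column identity**: if `deg (x^k fⁿ) < qr + q − 1` then
`U_q(x^k fⁿ) = Σ_{i<r} M_{ik} xⁱ` with `M = powCoeffMatrix f q n r c` — the extraction
«`∇` … maps `x^{(i+1)p−1}` … to `x^{ip}` … and annihilates monomials not of this form» applied to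
`x^{k} fⁿ`, all of whose contributing indices are `< r`. [cite: Sutherland2020, §2 eq. (4)–(5)] -/
theorem cartierTwist_X_pow_mul_pow_eq_sum (f : R[X]) {q : ℕ} (hq : q ≠ 0) (n r : ℕ) {c : ℕ}
    (k : Fin c) (hdeg : (X ^ k.val * f ^ n).natDegree < q * r + (q - 1)) :
    cartierTwist q (X ^ k.val * f ^ n) = ∑ i : Fin r, C (powCoeffMatrix f q n r c i k) * X ^ i.val := by
  ext m
  rw [finsetSum_coeff, coeff_cartierTwist hq]
  simp only [coeff_C_mul_X_pow]
  by_cases hm : m < r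
  · rw [Finset.sum_eq_single ⟨m, hm⟩ (fun i _ hi => if_neg fun h => hi (Fin.ext h.symm))
        (fun h => absurd (mem_univ _) h), if_pos rfl,
      powCoeffMatrix_apply_eq_coeff_X_pow_mul f (Nat.pos_of_ne_zero hq)]
  · rw [Finset.sum_eq_zero fun i _ => if_neg fun h : m = i.val => hm (h ▸ i.isLt)]
    apply coeff_eq_zero_of_natDegree_lt
    calc (X ^ k.val * f ^ n).natDegree < q * r + (q - 1) := hdeg
      _ ≤ q * m + (q - 1) := by
          have := Nat.mul_le_mul_left q (not_lt.mp hm)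
          omega

/-- The generic matrix form: for a coefficient vector `v : Fin c → R` with `c + n · deg f ≤ qr + q − 1`,
`U_q((Σ_k v_k x^k) fⁿ) = Σ_{i<r} (M · v)_i xⁱ`. [cite: Sutherland2020, §2 eq. (5)] -/
theorem cartierTwist_sum_mul_pow_eq_sum (f : R[X]) {q : ℕ} (hq : q ≠ 0) (n r : ℕ) {c : ℕ}
    (hdeg : c + n * f.natDegree ≤ q * r + (q - 1)) (v : Fin c → R) :
    cartierTwist q ((∑ k : Fin c, C (v k) * X ^ k.val) * f ^ n) =
      ∑ i : Fin r, C ((powCoeffMatrix f q n r c *ᵥ v) i) * X ^ i.val := by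
  have hk : ∀ k : Fin c, (X ^ k.val * f ^ n).natDegree < q * r + (q - 1) := fun k =>
    calc (X ^ k.val * f ^ n).natDegree ≤ (X ^ k.val : R[X]).natDegree + (f ^ n).natDegree :=
          natDegree_mul_le
      _ ≤ k.val + n * f.natDegree := add_le_add (natDegree_X_pow_le _) natDegree_pow_le
      _ < c + n * f.natDegree := by have := k.isLt; omega
      _ ≤ q * r + (q - 1) := hdeg
  rw [sum_mul, cartierTwist_sum hq]
  have key : ∀ k : Fin c, cartierTwist q (C (v k) * X ^ k.val * f ^ n) =
      ∑ i : Fin r, C (v k * powCoeffMatrix f q n r c i k) * X ^ i.val := fun k => by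
    rw [mul_assoc, cartierTwist_C_mul hq, cartierTwist_X_pow_mul_pow_eq_sum f hq n r k (hk k), mul_sum]
    refine sum_congr rfl fun i _ => ?_
    rw [← mul_assoc, ← C_mul]
  simp only [key]
  rw [sum_comm]
  refine sum_congr rfl fun i _ => ?_
  rw [← sum_mul, ← map_sum C]
  congr 2
  simp only [Matrix.mulVec, dotProduct, mul_comm]

end PowCoeff

/-! ### §1 Sutherland's blocks `b^{jℓ}` for `y^m = f(x)` -/

section Blocks

variable {R : Type*} [CommRing R]

/-- **The block sizes** `d_j := d − ⌊dj/m⌋ − 1` of Lemma 6 (6): the number of `i ≥ 1` with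
`mi + dj < md`, i.e. of basis differentials `ω_{ij} = x^{i−1} y^{j−1} dx/F_y` in the `j`-th block.
[cite: Sutherland2020, Lemma 6 eq. (6)] -/
def superellipticBlockSize (m d j : ℕ) : ℕ := d - d * j / m - 1

/-- **The exponents** `n_j := p − 1 − (jp − ℓ)/m` of (7) (depending on the pair `(j, ℓ)` with
`m ∣ jp − ℓ`): `F^{p−1}_{ip−k, jp−ℓ} = f^{n_j}_{ip−k}`. [cite: Sutherland2020, §2 eq. (7)] -/
def superellipticExponent (p m j ℓ : ℕ) : ℕ := p - 1 - (j * p - ℓ) / m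

/-- **The blocks `b^{jℓ}` of the Cartier–Manin matrix of `y^m = f(x)` before taking `p`-th roots**:
the `d_j × d_ℓ` matrix `(f^{n_j}_{ip−k})_{i ≤ d_j, k ≤ d_ℓ}` if `(jp − ℓ)/m ∈ ℤ_{≥0}` and `0`
otherwise («`B^{jℓ} := [(b^{jℓ}_{ik})^{1/p}]_{ik}`, `b^{jℓ}_{ik} := f^{n_j}_{ip−k}` if
`(jp−ℓ)/m ∈ ℤ_{≥0}`, `0` otherwise»; 0-indexed here: entry `(i, k)` is the printed `(i+1, k+1)`).
[cite: Sutherland2020, §2 eq. (8)] -/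
def superellipticBlock (f : R[X]) (p m d j ℓ : ℕ) :
    Matrix (Fin (superellipticBlockSize m d j)) (Fin (superellipticBlockSize m d ℓ)) R :=
  if m ∣ j * p - ℓ ∧ ℓ ≤ j * p then
    powCoeffMatrix f p (superellipticExponent p m j ℓ) (superellipticBlockSize m d j)
      (superellipticBlockSize m d ℓ)
  else 0

/-- Unfolding `d_j`. [cite: Sutherland2020, Lemma 6 eq. (6)] -/
theorem superellipticBlockSize_def (m d j : ℕ) : superellipticBlockSize m d j = d - d * j / m - 1 := rfl

/-- Unfolding `n_j`. [cite: Sutherland2020, §2 eq. (7)] -/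
theorem superellipticExponent_def (p m j ℓ : ℕ) :
    superellipticExponent p m j ℓ = p - 1 - (j * p - ℓ) / m := rfl

/-- The nonzero blocks: for `m ∣ jp − ℓ`, `ℓ ≤ jp`, `b^{jℓ} = (f^{n_j}_{ip−k})`.
[cite: Sutherland2020, §2 eq. (8)] -/
theorem superellipticBlock_of_dvd (f : R[X]) {p m d j ℓ : ℕ} (hdvd : m ∣ j * p - ℓ) (hle : ℓ ≤ j * p) :
    superellipticBlock f p m d j ℓ =
      powCoeffMatrix f p (superellipticExponent p m j ℓ) (superellipticBlockSize m d j)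
        (superellipticBlockSize m d ℓ) := by
  rw [superellipticBlock, if_pos ⟨hdvd, hle⟩]

/-- The zero blocks: if `(jp − ℓ)/m ∉ ℤ_{≥0}` then `b^{jℓ} = 0`. [cite: Sutherland2020, §2 eq. (8)] -/
theorem superellipticBlock_of_not (f : R[X]) {p m d j ℓ : ℕ} (h : ¬ (m ∣ j * p - ℓ ∧ ℓ ≤ j * p)) :
    superellipticBlock f p m d j ℓ = 0 := by
  rw [superellipticBlock, if_neg h]

/-- The entries of a nonzero block: `b^{jℓ}_{ik} = f^{n_j}_{ip−k}` (0-indexed: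
`[x^{p(i+1) − (k+1)}] f^{n_j}`, a negative index contributing `0`). [cite: Sutherland2020, §2 eq. (8)] -/
theorem superellipticBlock_apply (f : R[X]) {p m d j ℓ : ℕ} (hdvd : m ∣ j * p - ℓ) (hle : ℓ ≤ j * p)
    (i : Fin (superellipticBlockSize m d j)) (k : Fin (superellipticBlockSize m d ℓ)) :
    superellipticBlock f p m d j ℓ i k =
      if k.val + 1 ≤ p * (i.val + 1) then
        (f ^ superellipticExponent p m j ℓ).coeff (p * (i.val + 1) - (k.val + 1)) else 0 := by
  rw [superellipticBlock_of_dvd f hdvd hle, powCoeffMatrix_apply]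

/-- The condition «`(jp − ℓ)/m ∈ ℤ_{≥0}`», i.e. `m ∣ jp − ℓ` with `ℓ ≤ jp`, is `jp ≡ ℓ (mod m)` for
`ℓ < m` («`ℓ = jp rem m`»). [cite: Sutherland2020, §2 eq. (7)] -/
theorem superelliptic_dvd_iff_mod_eq {p m j ℓ : ℕ} (hℓ : ℓ < m) :
    (m ∣ j * p - ℓ ∧ ℓ ≤ j * p) ↔ (j * p) % m = ℓ := by
  constructor
  · rintro ⟨⟨c, hc⟩, hle⟩
    have h : j * p = ℓ + m * c := by omega
    rw [h, Nat.add_mul_mod_self_left, Nat.mod_eq_of_lt hℓ]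
  · intro h
    have h1 := Nat.div_add_mod (j * p) m
    rw [h] at h1
    exact ⟨⟨j * p / m, by omega⟩, by omega⟩

/-- The integer `(jp − ℓ)/m` is `< p` when `j < m` (so `n_j = p − 1 − (jp−ℓ)/m` involves no
truncation). [cite: Sutherland2020, §2 eq. (7)] -/
theorem superelliptic_div_lt {p m j ℓ : ℕ} (hj : j < m) (hp : 0 < p) :
    (j * p - ℓ) / m < p := by
  apply Nat.div_lt_of_lt_mul
  calc j * p - ℓ ≤ j * p := Nat.sub_le _ _
    _ < m * p := Nat.mul_lt_mul_of_pos_right hj hp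

/-- `m · n_j = (m − j)p − (m − ℓ)` («`n_j = ((m−j)p − (m−ℓ))/m`»), in the form
`m · n_j + jp + m = mp + ℓ`. [cite: Sutherland2020, §2 eq. (7)] -/
theorem mul_superellipticExponent_add {p m j ℓ : ℕ} (hj : j < m)
    (hdvd : m ∣ j * p - ℓ) (hle : ℓ ≤ j * p) (hp : 0 < p) :
    m * superellipticExponent p m j ℓ + j * p + m = m * p + ℓ := by
  have ht := Nat.div_mul_cancel hdvd
  have hlt := superelliptic_div_lt (ℓ := ℓ) hj hp
  rw [superellipticExponent, Nat.mul_sub, Nat.mul_sub, mul_comm m ((j * p - ℓ) / m), ht]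
  have h1 : m * ((j * p - ℓ) / m) ≤ m * (p - 1) := Nat.mul_le_mul_left m (by omega)
  rw [mul_comm m ((j * p - ℓ) / m), ht] at h1
  have h2 : m * 1 ≤ m * p := Nat.mul_le_mul_left m hp
  rw [Nat.mul_sub, mul_one] at *
  omega

/-- **The degree lemma** (the coefficient content of «it maps regular differentials to regular
differentials» for the basis of Lemma 6): for `j, ℓ < m` with `m ∣ jp − ℓ`, `ℓ ≤ jp`, `deg f ≤ d` and a
column index `k < d_ℓ`, `deg (x^k f^{n_j}) < p · d_j + (p − 1)` — so `U_p(x^k f^{n_j})` has degree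
`< d_j`, i.e. `𝒞(ω_{k+1, ℓ})` lies in the span of the `ω_{i j}`, `i ≤ d_j`.  The slack is exactly
`m · (p d_j + p − 1 − k − n_j d) = p (dj mod m) + m (d_ℓ − 1 − k) + (m − (dℓ mod m)) > 0`.
[cite: Sutherland2020, Lemma 6, Thm. 8] -/
theorem natDegree_lt_superelliptic {p m d j ℓ : ℕ} (hm : 0 < m) (hj : j < m)
    (hdvd : m ∣ j * p - ℓ) (hle : ℓ ≤ j * p) (hp : 0 < p) {f : R[X]} (hf : f.natDegree ≤ d)
    (k : Fin (superellipticBlockSize m d ℓ)) :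
    (X ^ k.val * f ^ superellipticExponent p m j ℓ).natDegree <
      p * superellipticBlockSize m d j + (p - 1) := by
  -- notation
  set n := superellipticExponent p m j ℓ with hn
  have hk := k.isLt
  simp only [superellipticBlockSize] at hk ⊢
  set A := d * j / m with hA
  set B := d * ℓ / m with hB
  have hAj : m * A + d * j % m = d * j := Nat.div_add_mod (d * j) m
  have hBl : m * B + d * ℓ % m = d * ℓ := Nat.div_add_mod (d * ℓ) m
  have hrj : d * j % m < m := Nat.mod_lt _ hm
  have hrl : d * ℓ % m < m := Nat.mod_lt _ hm
  have hd : 0 < d := by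
    by_contra h0
    have : d = 0 := by omega
    simp [this] at hk
  have hAd : A + 1 ≤ d := by
    have : A < d := by
      rw [hA]
      apply Nat.div_lt_of_lt_mul
      calc d * j < d * m := Nat.mul_lt_mul_of_pos_left hj hd
        _ = m * d := mul_comm _ _
    omega
  have hBd : B + 2 ≤ d := by omega
  have hmn := mul_superellipticExponent_add hj hdvd hle hp
  rw [← hn] at hmn
  -- the degree bound `deg (x^k f^n) ≤ k + n d`
  have hdeg : (X ^ k.val * f ^ n).natDegree ≤ k.val + n * d :=
    calc (X ^ k.val * f ^ n).natDegree ≤ (X ^ k.val : R[X]).natDegree + (f ^ n).natDegree :=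
          natDegree_mul_le
      _ ≤ k.val + n * f.natDegree := add_le_add (natDegree_X_pow_le _) natDegree_pow_le
      _ ≤ k.val + n * d := by gcongr
  -- the slack identity, in `ℤ`
  have key : (m : ℤ) * ((p : ℤ) * ((d : ℤ) - A - 1) + (p - 1) - (k.val + (n : ℤ) * d)) =
      (p : ℤ) * (d * j % m : ℕ) + (m : ℤ) * ((d : ℤ) - B - 2 - k.val) + ((m : ℤ) - (d * ℓ % m : ℕ)) := by
    have e1 : (m : ℤ) * A + (d * j % m : ℕ) = d * j := by exact_mod_cast hAj
    have e2 : (m : ℤ) * B + (d * ℓ % m : ℕ) = d * ℓ := by exact_mod_cast hBl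
    have e3 : (m : ℤ) * n + j * p + m = m * p + ℓ := by exact_mod_cast hmn
    linear_combination (-(p : ℤ)) * e1 + e2 - (d : ℤ) * e3
  have hpos : (0 : ℤ) < (p : ℤ) * ((d : ℤ) - A - 1) + (p - 1) - (k.val + (n : ℤ) * d) := by
    have h1 : (0 : ℤ) < (p : ℤ) * (d * j % m : ℕ) + (m : ℤ) * ((d : ℤ) - B - 2 - k.val) +
        ((m : ℤ) - (d * ℓ % m : ℕ)) := by
      have : (0 : ℤ) ≤ (d : ℤ) - B - 2 - k.val := by
        have := hk
        omega
      have h3 : (0 : ℤ) < (m : ℤ) - (d * ℓ % m : ℕ) := by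
        have := hrl
        omega
      positivity
    rw [← key] at h1
    exact pos_of_mul_pos_right h1 (by exact_mod_cast hm.le)
  have hfin : k.val + n * d < p * (d - A - 1) + (p - 1) := by
    have h1 : A ≤ d := by omega
    have h2 : 1 ≤ d - A := by omega
    have h3 : 1 ≤ p := hp
    zify [h1, h2, h3]
    linarith
  exact lt_of_le_of_lt hdeg hfin

/-- **(8) as an identity: `U_p(x^k f^{n_j}) = Σ_{i<d_j} b^{jℓ}_{ik} xⁱ` for `k < d_ℓ`** (`j, ℓ < m`,
`m ∣ jp − ℓ`, `ℓ ≤ jp`, `deg f ≤ d`; any commutative ring).  Multiplying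
«`𝒞(ω_{kℓ}) = Σ_i (b^{jℓ}_{ik})^{1/p} ω_{ij}`» by `m y^{m−j}` (and undoing the `p`-th roots) this is
`m y^{m−j} 𝒞(ω_{k+1,ℓ}) = 𝒞(x^k f^{n_j} dx)` computed — the block `b^{jℓ}` carries the `ℓ`-th block
of the basis of Lemma 6 into the `j`-th. [cite: Sutherland2020, §2 eq. (5), (8), Thm. 8] -/
theorem cartierTwist_X_pow_mul_pow_superelliptic (f : R[X]) {p m d j ℓ : ℕ} (hm : 0 < m) (hj : j < m)
    (hdvd : m ∣ j * p - ℓ) (hle : ℓ ≤ j * p) (hp : 0 < p) (hf : f.natDegree ≤ d)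
    (k : Fin (superellipticBlockSize m d ℓ)) :
    cartierTwist p (X ^ k.val * f ^ superellipticExponent p m j ℓ) =
      ∑ i : Fin (superellipticBlockSize m d j), C (superellipticBlock f p m d j ℓ i k) * X ^ i.val := by
  rw [superellipticBlock_of_dvd f hdvd hle]
  exact cartierTwist_X_pow_mul_pow_eq_sum f hp.ne' _ _ k
    (natDegree_lt_superelliptic hm hj hdvd hle hp hf k)

/-- **«this action is given by the matrix `B^{jℓ}`»** (twisted form): for a coefficient vector `v` on
the `ℓ`-th block, `U_p((Σ_k v_k x^k) f^{n_j}) = Σ_{i<d_j} (b^{jℓ} · v)_i xⁱ`.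
[cite: Sutherland2020, Thm. 8] -/
theorem cartierTwist_sum_mul_pow_superelliptic (f : R[X]) {p m d j ℓ : ℕ} (hm : 0 < m) (hj : j < m)
    (hdvd : m ∣ j * p - ℓ) (hle : ℓ ≤ j * p) (hp : 0 < p) (hf : f.natDegree ≤ d)
    (v : Fin (superellipticBlockSize m d ℓ) → R) :
    cartierTwist p ((∑ k : Fin (superellipticBlockSize m d ℓ), C (v k) * X ^ k.val) *
        f ^ superellipticExponent p m j ℓ) =
      ∑ i : Fin (superellipticBlockSize m d j), C ((superellipticBlock f p m d j ℓ *ᵥ v) i) * X ^ i.val := by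
  rw [sum_mul, cartierTwist_sum hp.ne']
  have key : ∀ k : Fin (superellipticBlockSize m d ℓ),
      cartierTwist p (C (v k) * X ^ k.val * f ^ superellipticExponent p m j ℓ) =
        ∑ i : Fin (superellipticBlockSize m d j), C (v k * superellipticBlock f p m d j ℓ i k) * X ^ i.val :=
    fun k => by
      rw [mul_assoc, cartierTwist_C_mul hp.ne', cartierTwist_X_pow_mul_pow_superelliptic f hm hj hdvd
        hle hp hf k, mul_sum]
      refine sum_congr rfl fun i _ => ?_
      rw [← mul_assoc, ← C_mul]
  simp only [key]
  rw [sum_comm]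
  refine sum_congr rfl fun i _ => ?_
  rw [← sum_mul, ← map_sum C]
  congr 2
  simp only [Matrix.mulVec, dotProduct, mul_comm]

/-- **Block selection («any nonzero `B^{jℓ}` must have `ℓ ≡ jp mod m`»)**: for `p` prime to `m` and
`0 < ℓ < m` there is exactly one `j < m` with `jp ≡ ℓ (mod m)`, and it is `> 0` — each column of
blocks of `A_p` carries exactly one nonzero block. [cite: Sutherland2020, §2 (8), Thm. 8] -/
theorem existsUnique_superelliptic_block {p m ℓ : ℕ} (hcop : Nat.Coprime p m) (hm : 1 < m)
    (hℓ : ℓ < m) : ∃! j, j < m ∧ (j * p) % m = ℓ := by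
  obtain ⟨u, -, hu⟩ := Nat.exists_mul_mod_eq_one_of_coprime hcop hm
  refine ⟨ℓ * u % m, ⟨Nat.mod_lt _ (by omega), ?_⟩, ?_⟩
  · rw [Nat.mod_mul_mod, mul_assoc, Nat.mul_mod, mul_comm u p, hu, mul_one, Nat.mod_mod,
      Nat.mod_eq_of_lt hℓ]
  · rintro j ⟨hj, hjp⟩
    have h1 : j * p % m = ℓ * u % m * p % m := by
      rw [hjp, Nat.mod_mul_mod, mul_assoc, Nat.mul_mod, mul_comm u p, hu, mul_one, Nat.mod_mod,
        Nat.mod_eq_of_lt hℓ]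
    have h2 : j ≡ ℓ * u % m [MOD m] :=
      Nat.ModEq.cancel_right_of_coprime (c := p) (by rwa [Nat.coprime_comm] at hcop) h1
    exact Nat.ModEq.eq_of_lt_of_lt h2 hj (Nat.mod_lt _ (by omega))

/-- The selected `j` is nonzero when `ℓ` is. [cite: Sutherland2020, §2 eq. (7)] -/
theorem superelliptic_block_pos {p m j ℓ : ℕ} (hℓ : 0 < ℓ) (h : (j * p) % m = ℓ) : 0 < j := by
  by_contra h0
  have : j = 0 := by omega
  rw [this, zero_mul, Nat.zero_mod] at h
  omega

/-- **«In particular, when `p ≡ 1 mod m` the Cartier operator fixes each of the subspaces»**: then the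
selected block is the diagonal one, `j = ℓ`. [cite: Sutherland2020, Thm. 8] -/
theorem superelliptic_block_self_of_mod_eq_one {p m ℓ : ℕ} (hp : p % m = 1) (hℓ : ℓ < m) :
    (ℓ * p) % m = ℓ := by
  rw [Nat.mul_mod, hp, mul_one, Nat.mod_mod, Nat.mod_eq_of_lt hℓ]

/-- For `p ≡ 1 (mod m)` the diagonal exponent is `n_j = (m − j)(p − 1)/m` («`n_j = ((m−j)p − (m−ℓ))/m`»
with `ℓ = j`). [cite: Sutherland2020, §2 eq. (7)] -/
theorem superellipticExponent_self_of_mod_eq_one {p m j : ℕ} (hm : 0 < m) (hp : p % m = 1) :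
    superellipticExponent p m j j = (m - j) * ((p - 1) / m) := by
  have hc : m * (p / m) + 1 = p := by
    have := Nat.div_add_mod p m
    rwa [hp] at this
  set c := p / m with hc_def
  have h1 : j * p = m * (j * c) + j := by
    rw [← hc]
    ring
  have h2 : j * p - j = m * (j * c) := by omega
  have h3 : p - 1 = m * c := by omega
  rw [superellipticExponent, h2, Nat.mul_div_cancel_left _ hm, h3, Nat.mul_div_cancel_left _ hm,
    Nat.sub_mul]

end Blocks

/-! ### §1′ Over a perfect ring: `B^{jℓ} = (b^{jℓ})^{1/p}` and the Cartier operator itself -/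

section Perfect

variable {R : Type*} [CommRing R] (p : ℕ) [Fact p.Prime] [CharP R p] [PerfectRing R p]

/-- **«`𝒞(ω_{kℓ}) = Σ_{i} (F^{p−1}_{ip−k,jp−ℓ})^{1/p} ω_{ij}`», `B^{jℓ} := [(b^{jℓ}_{ik})^{1/p}]`** at the level
of the polynomial forms: `𝒞(x^k f^{n_j} dx) = Σ_{i<d_j} (b^{jℓ}_{ik})^{τ} xⁱ dx`, `τ = σ^{−1}` the
`p`-th root on the perfect coefficient ring. [cite: Sutherland2020, §2 eq. (5), (8)] -/
theorem cartier_X_pow_mul_pow_superelliptic (f : R[X]) {m d j ℓ : ℕ} (hm : 0 < m) (hj : j < m)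
    (hdvd : m ∣ j * p - ℓ) (hle : ℓ ≤ j * p) (hf : f.natDegree ≤ d)
    (k : Fin (superellipticBlockSize m d ℓ)) :
    cartier p (X ^ k.val * f ^ superellipticExponent p m j ℓ) =
      ∑ i : Fin (superellipticBlockSize m d j),
        C ((frobeniusEquiv R p).symm (superellipticBlock f p m d j ℓ i k)) * X ^ i.val := by
  rw [cartier_def, cartierTwist_X_pow_mul_pow_superelliptic f hm hj hdvd hle (Fact.out : p.Prime).pos
    hf k, Polynomial.map_sum]
  refine sum_congr rfl fun i _ => ?_
  rw [Polynomial.map_mul, Polynomial.map_C, Polynomial.map_pow, Polynomial.map_X, RingEquiv.coe_toRingHom]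

/-- **Theorem 8, matrix form**: `𝒞((Σ_k v_k x^k) f^{n_j} dx) = Σ_{i<d_j} (B^{jℓ} · v^{τ})_i xⁱ dx` with
`B^{jℓ} = (b^{jℓ}).map τ` — «this action is given by the matrix `B^{jℓ}`», the `τ`-linearity of `𝒞`
being the `v^τ`. [cite: Sutherland2020, Thm. 8] -/
theorem cartier_sum_mul_pow_superelliptic (f : R[X]) {m d j ℓ : ℕ} (hm : 0 < m) (hj : j < m)
    (hdvd : m ∣ j * p - ℓ) (hle : ℓ ≤ j * p) (hf : f.natDegree ≤ d)
    (v : Fin (superellipticBlockSize m d ℓ) → R) :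
    cartier p ((∑ k : Fin (superellipticBlockSize m d ℓ), C (v k) * X ^ k.val) *
        f ^ superellipticExponent p m j ℓ) =
      ∑ i : Fin (superellipticBlockSize m d j),
        C ((((superellipticBlock f p m d j ℓ).map (frobeniusEquiv R p).symm) *ᵥ
          ((frobeniusEquiv R p).symm ∘ v)) i) * X ^ i.val := by
  rw [cartier_def, cartierTwist_sum_mul_pow_superelliptic f hm hj hdvd hle (Fact.out : p.Prime).pos
    hf v, Polynomial.map_sum]
  refine sum_congr rfl fun i _ => ?_
  rw [Polynomial.map_mul, Polynomial.map_C, Polynomial.map_pow, Polynomial.map_X,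
    RingHom.map_mulVec ((frobeniusEquiv R p).symm : R →+* R)]
  rfl

end Perfect

/-! ### §2 Consistency with the hyperelliptic case `m = 2`, and Example 7 (`m = 3`, `d = 5`) -/

section Examples

variable {R : Type*} [CommRing R]

/-- `m = 2`, `d = 2g + 1`: the single block has size `d_1 = g`. [cite: Sutherland2020, Lemma 6 eq. (6)] -/
theorem superellipticBlockSize_two_odd (g : ℕ) : superellipticBlockSize 2 (2 * g + 1) 1 = g := by
  rw [superellipticBlockSize]
  omega

/-- `m = 2`, `d = 2g + 2`: the single block has size `d_1 = g`. [cite: Sutherland2020, Lemma 6 eq. (6)] -/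
theorem superellipticBlockSize_two_even (g : ℕ) : superellipticBlockSize 2 (2 * g + 2) 1 = g := by
  rw [superellipticBlockSize]
  omega

/-- `m = 2`, `p` odd: the exponent is `n_1 = (p − 1)/2`, the hyperelliptic one.
[cite: Sutherland2020, §2 eq. (7)] -/
theorem superellipticExponent_two {p : ℕ} (hp : Odd p) : superellipticExponent p 2 1 1 = (p - 1) / 2 := by
  obtain ⟨u, rfl⟩ := hp
  rw [superellipticExponent]
  omega

/-- `m = 2`, `p` odd: the block condition `2 ∣ p − 1`, `1 ≤ p` holds. [cite: Sutherland2020, §2 eq. (8)] -/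
theorem superelliptic_dvd_two {p : ℕ} (hp : Odd p) : 2 ∣ 1 * p - 1 ∧ 1 ≤ 1 * p := by
  obtain ⟨u, rfl⟩ := hp
  exact ⟨⟨u, by omega⟩, by omega⟩

/-- **`m = 2` recovers the Hasse–Witt matrix**, `d = 2g + 1`: `b^{11}_{ik} = W_p(f)_{ik}` (the tree's
`hasseWittMatrix f p g`), indices transported along `d_1 = g`.
[cite: Sutherland2020, §2 eq. (8)] [cite: HarveySutherland2016, §1] -/
theorem superellipticBlock_two_apply_odd (f : R[X]) {p : ℕ} (hp : Odd p) (g : ℕ)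
    (i k : Fin (superellipticBlockSize 2 (2 * g + 1) 1)) :
    superellipticBlock f p 2 (2 * g + 1) 1 1 i k =
      hasseWittMatrix f p g (i.cast (superellipticBlockSize_two_odd g))
        (k.cast (superellipticBlockSize_two_odd g)) := by
  rw [superellipticBlock_of_dvd f (superelliptic_dvd_two hp).1 (superelliptic_dvd_two hp).2,
    superellipticExponent_two hp, powCoeffMatrix, of_apply, hasseWittMatrix, of_apply]
  rfl

/-- `m = 2`, `d = 2g + 2`: `b^{11}_{ik} = W_p(f)_{ik}` likewise. [cite: Sutherland2020, §2 eq. (8)]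
[cite: HarveySutherland2016, §1] -/
theorem superellipticBlock_two_apply_even (f : R[X]) {p : ℕ} (hp : Odd p) (g : ℕ)
    (i k : Fin (superellipticBlockSize 2 (2 * g + 2) 1)) :
    superellipticBlock f p 2 (2 * g + 2) 1 1 i k =
      hasseWittMatrix f p g (i.cast (superellipticBlockSize_two_even g))
        (k.cast (superellipticBlockSize_two_even g)) := by
  rw [superellipticBlock_of_dvd f (superelliptic_dvd_two hp).1 (superelliptic_dvd_two hp).2,
    superellipticExponent_two hp, powCoeffMatrix, of_apply, hasseWittMatrix, of_apply]
  rfl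

/-- **Example 7, `m = 3`, `d = 5`**: the block sizes are `d_1 = 3` and `d_2 = 1` («one `3 × 3`, one
`3 × 1`, one `1 × 3`, and one `1 × 1`»). [cite: Sutherland2020, Example 7] -/
theorem superellipticBlockSize_example_three_five :
    superellipticBlockSize 3 5 1 = 3 ∧ superellipticBlockSize 3 5 2 = 1 := by
  decide

/-- Example 7, `m = 3`, `p ≡ 1 (mod 3)`: the nonzero blocks are the diagonal ones, with exponents
`n_1 = (2p − 2)/3` and `n_2 = (p − 1)/3` (the entries `f^{(2p−2)/3}_{ip−k}`, `f^{(p−1)/3}_{p−1}` of the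
first displayed matrix). [cite: Sutherland2020, Example 7] -/
theorem superellipticExponent_example_three_one {p : ℕ} (hp : p % 3 = 1) :
    (3 ∣ 1 * p - 1 ∧ 1 ≤ 1 * p) ∧ (3 ∣ 2 * p - 2 ∧ 2 ≤ 2 * p) ∧
      superellipticExponent p 3 1 1 = (2 * p - 2) / 3 ∧ superellipticExponent p 3 2 2 = (p - 1) / 3 := by
  simp only [superellipticExponent]
  refine ⟨⟨⟨(p - 1) / 3, by omega⟩, by omega⟩, ⟨⟨(2 * p - 2) / 3, by omega⟩, by omega⟩, by omega, by omega⟩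

/-- Example 7, `m = 3`, `p ≡ 2 (mod 3)`: the nonzero blocks are `b^{12}` (`3 × 1`, exponent
`n = (2p − 1)/3`, entries `f^{(2p−1)/3}_{ip−1}`) and `b^{21}` (`1 × 3`, exponent `n = (p − 2)/3`), and
the diagonal blocks vanish («`tr A_p = 0` for `p ≢ 1 mod m`» here). [cite: Sutherland2020, Example 7] -/
theorem superellipticExponent_example_three_two {p : ℕ} (hp : p % 3 = 2) :
    (3 ∣ 1 * p - 2 ∧ 2 ≤ 1 * p) ∧ (3 ∣ 2 * p - 1 ∧ 1 ≤ 2 * p) ∧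
      ¬ (3 ∣ 1 * p - 1 ∧ 1 ≤ 1 * p) ∧ ¬ (3 ∣ 2 * p - 2 ∧ 2 ≤ 2 * p) ∧
      superellipticExponent p 3 1 2 = (2 * p - 1) / 3 ∧ superellipticExponent p 3 2 1 = (p - 2) / 3 := by
  simp only [superellipticExponent]
  refine ⟨⟨⟨(p - 2) / 3, by omega⟩, by omega⟩, ⟨⟨(2 * p - 1) / 3, by omega⟩, by omega⟩, ?_, ?_,
    by omega, by omega⟩
  · rintro ⟨⟨c, hc⟩, -⟩
    omega
  · rintro ⟨⟨c, hc⟩, -⟩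
    omega

end Examples

end Literature.AlgebraicGeometry.FiniteFields
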